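import Summits.NavierStokesRegularity.FluidComputer.LevelEnergyFloor

/-!
# Fluid computer — the level-FLATNESS floor (rung R2 read on the peak-factor axis; idea-1 gen 7 sketch, pub-fluidc)

HONEST FRAMING (cell `pub-fluidc`, verbatim): *low prior, high value-of-information experiment on Tao's
machine paradigm; NOT a claim that NS blows up.* Theorem side of the cell; nothing here is evidence of blow-up.

The amplitude rung tabulates, per energy-transfer step of scale ratio `λ`, the band sup-velocity gain
`g = U_out/U_in` and the level ratio `r = g/λ` against the machine floor `r ≥ 1`
(`LevelReynoldsFloor.level_amplitude_frequently_gt`, `LevelRatioFloor`).  The gen-7 instrument (HOME/atlas/IDEA-1.md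
§11, pub-fluidc-idea-1/return_map.py) factorises every certified gain EXACTLY as
`g = (R_out/R_in) · (F_g(M_out)/F_g(M_in)) · (c_out/c_in)` — rms amplitude ratio (`= √η_E`) × band-size factor ×
COHERENCE RETURN — where `F_B = U_B/R_B` is the band PEAK FACTOR (sup ÷ rms) and `c_B = F_B/F_g(M_B)` its excess over
the random-phase calibration (`ReturnMap.gain_factorisation` below is that identity).  In a cascade the input of step
`n+1` is the output of step `n`, so the coherence returns telescope (`ReturnMap.prod_ratio_telescope`) and a
sustained floor `r ≥ 1` with the other two factors bounded by `q·λ` forces `c_N ≥ c_0 q^{-N}`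
(`ReturnMap.coherence_growth_of_sustained_floor`): the level-`N` band of a machine must be exponentially
super-Gaussian.  The tail theorem of this file is the solution-side face of that bookkeeping, the THIRD floor of the
rung after amplitude (`LevelReynoldsFloor` / `LevelRatioFloor`) and energy (`LevelEnergyFloor`):

* `block_rms_le_energy` — energy ceiling of a single block at a single time: `‖Δ̇_j U(t)‖₂ ≤ C ‖u 0‖₂` for an
  unforced Leray–Hopf solution (from `LevelEnergyFloor.rms_weight_le_energy`).
* `level_flatness_floor` (**the flatness floor**) — for every maximal smooth solution with finite lifespan `T`,
  Leray–Hopf from `u 0`: at INFINITELY MANY levels `j` some time `t ∈ (0,T)` has BOTH `c ν 2^j < ‖Δ̇_j U(t)‖_∞`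
  (the sup floor) AND `‖Δ̇_j U(t)‖₂ ≤ C ‖u 0‖₂` (the energy ceiling) — so the block's peak factor
  `‖Δ̇_j U(t)‖_∞ / ‖Δ̇_j U(t)‖₂` exceeds `(c ν /(C ‖u 0‖₂)) · 2^j`: it grows at least like the WAVENUMBER.
* `level_peak_factor_floor` — the same as one product inequality
  `c ν · 2^j · ‖Δ̇_j U(t)‖₂ ≤ C ‖u 0‖₂ · ‖Δ̇_j U(t)‖_∞` infinitely often.
* `block_sup_le_bernstein_rms` — the solution-free Bernstein ceiling `‖Δ̇_j V‖_∞ ≤ C₁ 2^{3j/2} ‖Δ̇_j V‖₂` that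
  brackets the peak factor from above.  DICTIONARY (hedged; Cheskidov–Shvydkoy arXiv:1102.1944 define an
  intermittency dimension `D` by the saturation `‖Δ̇_j u‖_∞ ≈ 2^{(3-D)j/2} ‖Δ̇_j u‖₂` and prove regularity for
  `D > 3/2`, their Thm 5.1, in a time-averaged sense): the floor says the saturation exponent is `≥ 1 = (3-D)/2`,
  i.e. `D ≤ 1`, at infinitely many levels in the sup-over-`(0,T)` sense — blow-up blocks are at least as
  concentrated as TUBES on the peak-factor axis.  The cell's certified transfer events shed `κ ≈ 1` volume
  dimension per step (sheets); nothing in this file says which geometries can do better.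

No statement about any fixed finite set of levels is made or implied.

## References

* A. Cheskidov, R. Shvydkoy, *The regularity of weak solutions of the 3D Navier–Stokes equations in
  `B^{-1}_{∞,∞}`*, Arch. Ration. Mech. Anal. 195 (2010) 159–169 = arXiv:0708.3067, Lemma 3.2. [CheskidovShvydkoy2010]
* A. Cheskidov, R. Shvydkoy, *Euler equations and turbulence: analytical approach to intermittency*,
  SIAM J. Math. Anal. 46 (2014) 353–374 = arXiv:1102.1944, §5 (intermittency dimension, Thm 5.1). [CheskidovShvydkoy2014]
-/

noncomputable section

open MeasureTheory Set Function Filter Topology TemperedDistribution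
open scoped ENNReal NNReal SchwartzMap
open Literature.Analysis.FluidPDE Literature.Analysis.FunctionSpaces

namespace Summit.NavierStokesRegularity.FluidComputer.LevelFlatnessFloor

/-- **Energy ceiling of a single block at a single time.** There is an absolute `C` such that for every unforced
Leray–Hopf solution on `[0,T]` from `u 0` with slice distributions `U t`, every level `j` and every `t ∈ (0,T)`:
`‖Δ̇_j U(t)‖_{L²} ≤ C ‖u 0‖_{L²}` (from `LevelEnergyFloor.rms_weight_le_energy`, cancelling the finite nonzero
weight `2^{j/2}`). [folklore] -/
theorem block_rms_le_energy : ∃ C : ℝ≥0, ∀ (ν T : ℝ), 0 < ν → 0 < T →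
    ∀ (u : ℝ → EuclideanSpace ℝ (Fin 3) → EuclideanSpace ℝ (Fin 3))
      (U : ℝ → 𝓢'(EuclideanSpace ℝ (Fin 3), EuclideanSpace ℂ (Fin 3))),
      IsLerayHopfOn T ν 0 (u 0) u → (∀ t ∈ Icc 0 T, IsDistributionOf (u t) (U t)) →
      ∀ (j : ℕ), ∀ t ∈ Ioo 0 T, eLpNormDistrib 2 (lpBlock (j : ℤ) (U t)) ≤ C * eLpNorm (u 0) 2 volume := by
  obtain ⟨C, hC⟩ := LevelEnergyFloor.rms_weight_le_energy
  refine ⟨C, fun ν T hν hT u U hLH hU j t ht => ?_⟩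
  have h := hC ν T hν hT u U hLH hU j
  have hle : eLpNormDistrib 2 (lpBlock (j : ℤ) (U t)) ≤ ⨆ t ∈ Ioo 0 T, eLpNormDistrib 2 (lpBlock (j : ℤ) (U t)) :=
    le_iSup₂ (f := fun t (_ : t ∈ Ioo 0 T) => eLpNormDistrib 2 (lpBlock (j : ℤ) (U t))) t ht
  have hne0 : (2 : ℝ≥0∞) ^ ((j : ℝ) / 2) ≠ 0 := by
    rw [Ne, ENNReal.rpow_eq_zero_iff]; norm_num
  have hnet : (2 : ℝ≥0∞) ^ ((j : ℝ) / 2) ≠ ∞ := by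
    rw [Ne, ENNReal.rpow_eq_top_iff]; norm_num
  have h' : (2 : ℝ≥0∞) ^ ((j : ℝ) / 2) * eLpNormDistrib 2 (lpBlock (j : ℤ) (U t)) ≤
      (2 : ℝ≥0∞) ^ ((j : ℝ) / 2) * (C * eLpNorm (u 0) 2 volume) :=
    calc (2 : ℝ≥0∞) ^ ((j : ℝ) / 2) * eLpNormDistrib 2 (lpBlock (j : ℤ) (U t))
        ≤ (2 : ℝ≥0∞) ^ ((j : ℝ) / 2) * ⨆ t ∈ Ioo 0 T, eLpNormDistrib 2 (lpBlock (j : ℤ) (U t)) :=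
          mul_le_mul' le_rfl hle
      _ ≤ C * (2 : ℝ≥0∞) ^ ((j : ℝ) / 2) * eLpNorm (u 0) 2 volume := h
      _ = (2 : ℝ≥0∞) ^ ((j : ℝ) / 2) * (C * eLpNorm (u 0) 2 volume) := by ring
  exact (ENNReal.mul_le_mul_iff_right hne0 hnet).1 h'

/-- **The flatness floor (gen 7).** There are absolute constants `c > 0` and `C` such that for every `ν > 0`,
`T > 0`, every maximal smooth solution `(u, p)` of the unforced Navier–Stokes system on `ℝ³ × [0,T)` (no classical
continuation past `T`) which is Leray–Hopf from `u 0`, with slice distributions `U t`: at INFINITELY MANY dyadic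
levels `j` there is a time `t ∈ (0,T)` with BOTH `c ν · 2^j < ‖Δ̇_j U(t)‖_{L^∞}` (the level-Reynolds floor,
`LevelReynoldsFloor.level_amplitude_frequently_gt`) AND `‖Δ̇_j U(t)‖_{L²} ≤ C ‖u 0‖_{L²}` (the energy ceiling,
`block_rms_le_energy`).  Hence the block's peak factor `‖Δ̇_j U(t)‖_∞ / ‖Δ̇_j U(t)‖₂` exceeds
`(c ν / (C ‖u 0‖₂)) · 2^j` infinitely often: sup ÷ rms grows at least like the wavenumber (saturation exponent ≥ 1 of
Bernstein's `3/2`, `block_sup_le_bernstein_rms`; intermittency dimension ≤ 1 in the dictionary of the module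
docstring).  Nothing is asserted about any fixed finite set of levels. [cite: CheskidovShvydkoy2010, Lemma 3.2] -/
theorem level_flatness_floor : ∃ (c : ℝ) (C : ℝ≥0), 0 < c ∧
    ∀ (ν T : ℝ), 0 < ν → 0 < T → ∀ (u : ℝ → EuclideanSpace ℝ (Fin 3) → EuclideanSpace ℝ (Fin 3))
      (p : ℝ → EuclideanSpace ℝ (Fin 3) → ℝ)
      (U : ℝ → 𝓢'(EuclideanSpace ℝ (Fin 3), EuclideanSpace ℂ (Fin 3))),
      IsMaximalSmoothSolution ν 0 u p T → IsLerayHopfOn T ν 0 (u 0) u →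
      (∀ t ∈ Icc 0 T, IsDistributionOf (u t) (U t)) →
        ∃ᶠ j : ℕ in atTop, ∃ t ∈ Ioo 0 T,
          ENNReal.ofReal (c * ν) * 2 ^ j < eLpNormDistrib ∞ (lpBlock (j : ℤ) (U t)) ∧
          eLpNormDistrib 2 (lpBlock (j : ℤ) (U t)) ≤ C * eLpNorm (u 0) 2 volume := by
  obtain ⟨c, hc, H⟩ := LevelReynoldsFloor.level_amplitude_frequently_gt
  obtain ⟨C, hC⟩ := block_rms_le_energy
  refine ⟨c / 2, C, by linarith, fun ν T hν hT u p U hmax hLH hU => ?_⟩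
  have hb : c / 2 < c := by linarith
  have hfreq := H ν T hν hT u p U hmax hLH hU (c / 2) hb
  refine hfreq.mono fun j hj => ?_
  rw [lt_iSup_iff] at hj
  obtain ⟨t, hjt⟩ := hj
  rw [lt_iSup_iff] at hjt
  obtain ⟨ht, hlt⟩ := hjt
  refine ⟨t, ht, ?_, hC ν T hν hT u U hLH hU j t ht⟩
  simp only [lpBlockWeight] at hlt
  have hne0 : (2 : ℝ≥0∞) ^ j ≠ 0 := pow_ne_zero _ two_ne_zero
  have hnet : (2 : ℝ≥0∞) ^ j ≠ ∞ := ENNReal.pow_ne_top ENNReal.ofNat_ne_top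
  have hexp : ((j : ℕ) : ℝ) + ((j : ℤ) : ℝ) * (-1 : ℝ) = 0 := by push_cast; ring
  have hpow : (2 : ℝ≥0∞) ^ j * (2 : ℝ≥0∞) ^ (((j : ℤ) : ℝ) * (-1 : ℝ)) = 1 := by
    rw [← ENNReal.rpow_natCast, ← ENNReal.rpow_add _ _ (by norm_num) (by norm_num), hexp, ENNReal.rpow_zero]
  calc ENNReal.ofReal (c / 2 * ν) * 2 ^ j
      = (2 : ℝ≥0∞) ^ j * ENNReal.ofReal (c / 2 * ν) := mul_comm _ _
    _ < (2 : ℝ≥0∞) ^ j * ((2 : ℝ≥0∞) ^ (((j : ℤ) : ℝ) * (-1 : ℝ)) * eLpNormDistrib ∞ (lpBlock (j : ℤ) (U t))) :=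
        ENNReal.mul_lt_mul_right hne0 hnet hlt
    _ = eLpNormDistrib ∞ (lpBlock (j : ℤ) (U t)) := by rw [← mul_assoc, hpow, one_mul]

/-- **Peak-factor form of the flatness floor.** With the constants of `level_flatness_floor`: at infinitely many
levels `j`, some `t ∈ (0,T)` has `c ν · 2^j · ‖Δ̇_j U(t)‖₂ ≤ C ‖u 0‖₂ · ‖Δ̇_j U(t)‖_∞` — the product form of
"peak factor ≥ (c ν / (C ‖u 0‖₂)) 2^j", division-free in `ℝ≥0∞`. [cite: CheskidovShvydkoy2010, Lemma 3.2] -/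
theorem level_peak_factor_floor : ∃ (c : ℝ) (C : ℝ≥0), 0 < c ∧
    ∀ (ν T : ℝ), 0 < ν → 0 < T → ∀ (u : ℝ → EuclideanSpace ℝ (Fin 3) → EuclideanSpace ℝ (Fin 3))
      (p : ℝ → EuclideanSpace ℝ (Fin 3) → ℝ)
      (U : ℝ → 𝓢'(EuclideanSpace ℝ (Fin 3), EuclideanSpace ℂ (Fin 3))),
      IsMaximalSmoothSolution ν 0 u p T → IsLerayHopfOn T ν 0 (u 0) u →
      (∀ t ∈ Icc 0 T, IsDistributionOf (u t) (U t)) →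
        ∃ᶠ j : ℕ in atTop, ∃ t ∈ Ioo 0 T,
          ENNReal.ofReal (c * ν) * 2 ^ j * eLpNormDistrib 2 (lpBlock (j : ℤ) (U t)) ≤
            C * eLpNorm (u 0) 2 volume * eLpNormDistrib ∞ (lpBlock (j : ℤ) (U t)) := by
  obtain ⟨c, C, hc, H⟩ := level_flatness_floor
  refine ⟨c, C, hc, fun ν T hν hT u p U hmax hLH hU => ?_⟩
  refine (H ν T hν hT u p U hmax hLH hU).mono fun j hj => ?_
  obtain ⟨t, ht, hsup, hrms⟩ := hj
  refine ⟨t, ht, ?_⟩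
  calc ENNReal.ofReal (c * ν) * 2 ^ j * eLpNormDistrib 2 (lpBlock (j : ℤ) (U t))
      ≤ eLpNormDistrib ∞ (lpBlock (j : ℤ) (U t)) * (C * eLpNorm (u 0) 2 volume) := mul_le_mul' hsup.le hrms
    _ = C * eLpNorm (u 0) 2 volume * eLpNormDistrib ∞ (lpBlock (j : ℤ) (U t)) := by ring

/-- **Bernstein ceiling of the peak factor (solution-free).** There is an absolute `C₁` with
`‖Δ̇_j V‖_{L^∞} ≤ C₁ · 2^{3j/2} · ‖Δ̇_j V‖_{L²}` for every tempered distribution `V` on `ℝ³` and every level `j`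
(`exists_eLpNormDistrib_lpBlock_le 2 ∞`).  With `level_flatness_floor` this BRACKETS the peak factor of a blow-up
block between `(c ν /(C ‖u 0‖₂)) 2^j` and `C₁ 2^{3j/2}` at infinitely many levels. [folklore] -/
theorem block_sup_le_bernstein_rms : ∃ C₁ : ℝ≥0,
    ∀ (V : 𝓢'(EuclideanSpace ℝ (Fin 3), EuclideanSpace ℂ (Fin 3))) (j : ℕ),
      eLpNormDistrib ∞ (lpBlock (j : ℤ) V) ≤ C₁ * (2 : ℝ≥0∞) ^ (3 * (j : ℝ) / 2) * eLpNormDistrib 2 (lpBlock (j : ℤ) V) := by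
  obtain ⟨C₁, -, hB⟩ := exists_eLpNormDistrib_lpBlock_le
    (E := EuclideanSpace ℝ (Fin 3)) (F := EuclideanSpace ℂ (Fin 3)) 2 ∞ le_top
  refine ⟨C₁, fun V j => ?_⟩
  have hexp : ((j : ℤ) : ℝ) * Module.finrank ℝ (EuclideanSpace ℝ (Fin 3)) *
      ((2 : ℝ≥0∞).toReal⁻¹ - (∞ : ℝ≥0∞).toReal⁻¹) = 3 * (j : ℝ) / 2 := by
    simp; ring
  have hb := hB (j : ℤ) V
  rw [hexp] at hb
  exact hb

/-! ## The return map: finite bookkeeping of the instrument (over `ℝ`)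

Per step: input band amplitude `U_in > 0`, rms `R_in > 0`, calibration `Fg_in > 0`; output `U_out`, `R_out > 0`,
`Fg_out > 0`; peak factors `F = U/R`, coherence excesses `c = F/Fg`.  The gain factorises; along a cascade the
coherence returns telescope; a sustained floor forces geometric growth of the coherence excess. -/

namespace ReturnMap

/-- **Gain factorisation** `g = (R_out/R_in) · (Fg_out/Fg_in) · (c_out/c_in)` with `c = (U/R)/Fg` — an identity of
real numbers (all denominators nonzero).  In the cell's units `R = √(2E)`, so the first factor is `√η_E`. -/
theorem gain_factorisation {Uin Uout Rin Rout Fgin Fgout : ℝ} (hUin : Uin ≠ 0) (hRin : Rin ≠ 0)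
    (hRout : Rout ≠ 0) (hFgin : Fgin ≠ 0) (hFgout : Fgout ≠ 0) :
    Uout / Uin = (Rout / Rin) * (Fgout / Fgin) * ((Uout / Rout / Fgout) / (Uin / Rin / Fgin)) := by
  field_simp

/-- **Telescoping of the coherence returns**: `∏_{n<N} c(n+1)/c(n) = c(N)/c(0)` for a nowhere-zero sequence. -/
theorem prod_ratio_telescope (c : ℕ → ℝ) (hc : ∀ n, c n ≠ 0) (N : ℕ) :
    ∏ n ∈ Finset.range N, c (n + 1) / c n = c N / c 0 := by
  induction N with
  | zero => simp [hc 0]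
  | succ N ih =>
    rw [Finset.prod_range_succ, ih]
    have h0 := hc 0
    have hN := hc N
    field_simp

/-- **Coherence growth under a sustained floor.** If each step's level ratio factorises as
`r n = s n · (c (n+1) / c n)` with `0 < s n ≤ q` (the energy × band-size part, `√η_E · Γ / λ` in the cell's
units) and positive coherence excesses `c n`, and the floor `r n ≥ 1` holds at every step, then
`c 0 ≤ q^N · c N` for all `N` — with `q < 1` the coherence excess must grow at least like `q^{-N}`. -/
theorem coherence_growth_of_sustained_floor (c s r : ℕ → ℝ) (q : ℝ) (hc : ∀ n, 0 < c n)
    (hs : ∀ n, 0 < s n) (hsq : ∀ n, s n ≤ q) (hr : ∀ n, 1 ≤ r n)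
    (hfac : ∀ n, r n = s n * (c (n + 1) / c n)) : ∀ N, c 0 ≤ q ^ N * c N := by
  have hq0 : 0 ≤ q := (hs 0).le.trans (hsq 0)
  intro N
  induction N with
  | zero => simp
  | succ N ih =>
    have h1 : c N ≤ s N * c (N + 1) := by
      have h := hr N
      rw [hfac N, ← mul_div_assoc, le_div_iff₀ (hc N), one_mul] at h
      exact h
    have h2 : s N * c (N + 1) ≤ q * c (N + 1) := mul_le_mul_of_nonneg_right (hsq N) (hc (N + 1)).le
    calc c 0 ≤ q ^ N * c N := ih
      _ ≤ q ^ N * (q * c (N + 1)) := mul_le_mul_of_nonneg_left (h1.trans h2) (pow_nonneg hq0 N)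
      _ = q ^ (N + 1) * c (N + 1) := by ring

/-- The same as an explicit lower bound `c 0 / q^N ≤ c N` (for `q > 0`). -/
theorem coherence_lower_bound (c s r : ℕ → ℝ) (q : ℝ) (hq : 0 < q) (hc : ∀ n, 0 < c n)
    (hs : ∀ n, 0 < s n) (hsq : ∀ n, s n ≤ q) (hr : ∀ n, 1 ≤ r n)
    (hfac : ∀ n, r n = s n * (c (n + 1) / c n)) (N : ℕ) : c 0 / q ^ N ≤ c N := by
  have h := coherence_growth_of_sustained_floor c s r q hc hs hsq hr hfac N
  rw [div_le_iff₀ (pow_pos hq N)]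
  linarith [mul_comm (q ^ N) (c N)]

end ReturnMap

end Summit.NavierStokesRegularity.FluidComputer.LevelFlatnessFloor
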